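import Summits.CriticalPhenomena.PercolationContinuityZ3.Theorems.Transplant.FKConnectivityAllQPat3EeeKTriAdbdStarXmA
import HarnessLib

/-!
# Connectivity correlation inequalities for `φ_{w,q}`, every `q > 0` — THE LEAF EEEtri IN THE K-STATE `adbd` (contracted plain slots), target `mirror2 starXTab`: kernel-checked tabulated certificate over `famP11` + orbit cells (census g41, kit j242142) — part B: products, representative loops, rows

Data file (`--supports stmt-CriticalPhenomena-4575`), census lineage (gen 41) of LANE 2's FK sub-programme; builds on p205010 (kernel
theorem, internal audit signed; external expert review pending).  Literals + `decide +kernel` facts, elaborated sequentially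
(`set_option Elab.async false`, census g36's memory rule); no sorries; standard axioms.

THE SHAPE EEEtri (names `Fin 7`: `a b c d = 0 1 2 3`, piece marks `4 5 6` in census g39's piece order; free plain slots `[('c', 'd')]`, CONTRACTED `[('a', 'd'), ('b', 'd')]` — census g41: the (E, C)-minor form needs every state).
This file (part B): the products `…Prods`, the generator-symmetry fact `…_sym`, the fifteen representative first-pair loops `…_rep_P_Q` (`FK.loop1R`, kernel), their assembly `…_reps`, and **`…_rows`** — the rowwise domination `8·Σ λ·tensor ≤ D·symm8d (coefTab3K …)` that `FK.shape3KC_nonneg_of_rows` turns into levelwise nonnegativity of the target on every composite minor of this shape.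
Conventions (census g41 `shape_to_lean.py`, verified against census g39's `glue_side`/LP): names = vertex indices then piece marks;
residual level `d` = g39 row index `+ K` (`K = ne + 2|K| + 6t − 2(n + t)`, census g41 K-state form), Lean shift `= K − s`, `B = max (2·ne + 2, max shift)`, levels `d < B + 2t`; products
`(λ, shift, i_K, i₁, i₂)` index `FK.famP11orb` (0–10 = `famP11`, 11–25 = orbit cells); generator tables symmetric (`FK.prodsSym`), so the
fifteen orbit-representative first-pair loops `FK.loop1R` suffice (`FK.rows_of_tab3RK`).
[cite: AyyerLinussonRavichandran2025, §7 (p. 22)]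
-/

namespace Summit.CriticalPhenomena.PercolationContinuityZ3.Theorems

namespace FK

set_option Elab.async false

open SimpleGraph Literature.Probability.LatticeModels Literature.Probability.Percolation
open scoped Classical

variable {V : Type*}
/-- Census g39's exact certificate for `EEEtri_Kadbd` × `mirror2 starXTab`: products `(λ, shift, i_K, i₁, i₂)` over `famP11orb` (17 products, D = 8). [folklore] -/
def eeeKtriadbd_starXmProds : List Prod3 :=
  ([(2, 3, 0, 0, 17), (1, 1, 0, 1, 1), (1, 2, 0, 17, 0), (1, 2, 0, 17, 2), (2, 4, 0, 17, 17), (2, 3, 4, 0, 17), (1, 1, 4, 1, 1), (2, 3, 4, 17, 0), (2, 3, 11, 1, 1), (4, 4, 11, 17, 1), (1, 3, 12, 1, 1), (2, 4, 12, 17, 1), (1, 2, 13, 1, 1), (1, 2, 14, 1, 1), (1, 2, 17, 1, 1), (1, 2, 18, 1, 1), (2, 1, 21, 1, 1)] : List (ℕ × ℕ × ℕ × ℕ × ℕ)).map (Prod3.ofIdx famP11orb)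


set_option maxHeartbeats 4000000 in
/-- Every generator table of the certificate is symmetric (orbit-representative rows suffice). -/
theorem eeeKtriadbd_starXm_sym : prodsSym eeeKtriadbd_starXmProds = true := by
  decide +kernel


set_option maxHeartbeats 4000000 in
/-- Representative first-pair loop `(Pat3.all, Pat3.all)` (census g40 `FK.loop1R`: second/third pairs `P ≤ Q` only; target `symm8d (coefGet3 …)`, `m = 8`). -/
theorem eeeKtriadbd_starXm_rep_0_0 :
    loop1R (symm8d (coefGet3 eeeKtriadbd_starXmCoef)) 8 8 8 (eeeKtriadbd_starXmProds.filter fun p => suppAt p.gK Pat3.all Pat3.all) Pat3.all Pat3.all = true := by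
  decide +kernel


set_option maxHeartbeats 4000000 in
/-- Representative first-pair loop `(Pat3.all, Pat3.xy_s)` (census g40 `FK.loop1R`: second/third pairs `P ≤ Q` only; target `symm8d (coefGet3 …)`, `m = 8`). -/
theorem eeeKtriadbd_starXm_rep_0_1 :
    loop1R (symm8d (coefGet3 eeeKtriadbd_starXmCoef)) 8 8 8 (eeeKtriadbd_starXmProds.filter fun p => suppAt p.gK Pat3.all Pat3.xy_s) Pat3.all Pat3.xy_s = true := by
  decide +kernel


set_option maxHeartbeats 4000000 in
/-- Representative first-pair loop `(Pat3.all, Pat3.xs_y)` (census g40 `FK.loop1R`: second/third pairs `P ≤ Q` only; target `symm8d (coefGet3 …)`, `m = 8`). -/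
theorem eeeKtriadbd_starXm_rep_0_2 :
    loop1R (symm8d (coefGet3 eeeKtriadbd_starXmCoef)) 8 8 8 (eeeKtriadbd_starXmProds.filter fun p => suppAt p.gK Pat3.all Pat3.xs_y) Pat3.all Pat3.xs_y = true := by
  decide +kernel


set_option maxHeartbeats 4000000 in
/-- Representative first-pair loop `(Pat3.all, Pat3.ys_x)` (census g40 `FK.loop1R`: second/third pairs `P ≤ Q` only; target `symm8d (coefGet3 …)`, `m = 8`). -/
theorem eeeKtriadbd_starXm_rep_0_3 :
    loop1R (symm8d (coefGet3 eeeKtriadbd_starXmCoef)) 8 8 8 (eeeKtriadbd_starXmProds.filter fun p => suppAt p.gK Pat3.all Pat3.ys_x) Pat3.all Pat3.ys_x = true := by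
  decide +kernel


set_option maxHeartbeats 4000000 in
/-- Representative first-pair loop `(Pat3.all, Pat3.sep)` (census g40 `FK.loop1R`: second/third pairs `P ≤ Q` only; target `symm8d (coefGet3 …)`, `m = 8`). -/
theorem eeeKtriadbd_starXm_rep_0_4 :
    loop1R (symm8d (coefGet3 eeeKtriadbd_starXmCoef)) 8 8 8 (eeeKtriadbd_starXmProds.filter fun p => suppAt p.gK Pat3.all Pat3.sep) Pat3.all Pat3.sep = true := by
  decide +kernel


set_option maxHeartbeats 4000000 in
/-- Representative first-pair loop `(Pat3.xy_s, Pat3.xy_s)` (census g40 `FK.loop1R`: second/third pairs `P ≤ Q` only; target `symm8d (coefGet3 …)`, `m = 8`). -/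
theorem eeeKtriadbd_starXm_rep_1_1 :
    loop1R (symm8d (coefGet3 eeeKtriadbd_starXmCoef)) 8 8 8 (eeeKtriadbd_starXmProds.filter fun p => suppAt p.gK Pat3.xy_s Pat3.xy_s) Pat3.xy_s Pat3.xy_s = true := by
  decide +kernel


set_option maxHeartbeats 4000000 in
/-- Representative first-pair loop `(Pat3.xy_s, Pat3.xs_y)` (census g40 `FK.loop1R`: second/third pairs `P ≤ Q` only; target `symm8d (coefGet3 …)`, `m = 8`). -/
theorem eeeKtriadbd_starXm_rep_1_2 :
    loop1R (symm8d (coefGet3 eeeKtriadbd_starXmCoef)) 8 8 8 (eeeKtriadbd_starXmProds.filter fun p => suppAt p.gK Pat3.xy_s Pat3.xs_y) Pat3.xy_s Pat3.xs_y = true := by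
  decide +kernel


set_option maxHeartbeats 4000000 in
/-- Representative first-pair loop `(Pat3.xy_s, Pat3.ys_x)` (census g40 `FK.loop1R`: second/third pairs `P ≤ Q` only; target `symm8d (coefGet3 …)`, `m = 8`). -/
theorem eeeKtriadbd_starXm_rep_1_3 :
    loop1R (symm8d (coefGet3 eeeKtriadbd_starXmCoef)) 8 8 8 (eeeKtriadbd_starXmProds.filter fun p => suppAt p.gK Pat3.xy_s Pat3.ys_x) Pat3.xy_s Pat3.ys_x = true := by
  decide +kernel


set_option maxHeartbeats 4000000 in
/-- Representative first-pair loop `(Pat3.xy_s, Pat3.sep)` (census g40 `FK.loop1R`: second/third pairs `P ≤ Q` only; target `symm8d (coefGet3 …)`, `m = 8`). -/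
theorem eeeKtriadbd_starXm_rep_1_4 :
    loop1R (symm8d (coefGet3 eeeKtriadbd_starXmCoef)) 8 8 8 (eeeKtriadbd_starXmProds.filter fun p => suppAt p.gK Pat3.xy_s Pat3.sep) Pat3.xy_s Pat3.sep = true := by
  decide +kernel


set_option maxHeartbeats 4000000 in
/-- Representative first-pair loop `(Pat3.xs_y, Pat3.xs_y)` (census g40 `FK.loop1R`: second/third pairs `P ≤ Q` only; target `symm8d (coefGet3 …)`, `m = 8`). -/
theorem eeeKtriadbd_starXm_rep_2_2 :
    loop1R (symm8d (coefGet3 eeeKtriadbd_starXmCoef)) 8 8 8 (eeeKtriadbd_starXmProds.filter fun p => suppAt p.gK Pat3.xs_y Pat3.xs_y) Pat3.xs_y Pat3.xs_y = true := by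
  decide +kernel


set_option maxHeartbeats 4000000 in
/-- Representative first-pair loop `(Pat3.xs_y, Pat3.ys_x)` (census g40 `FK.loop1R`: second/third pairs `P ≤ Q` only; target `symm8d (coefGet3 …)`, `m = 8`). -/
theorem eeeKtriadbd_starXm_rep_2_3 :
    loop1R (symm8d (coefGet3 eeeKtriadbd_starXmCoef)) 8 8 8 (eeeKtriadbd_starXmProds.filter fun p => suppAt p.gK Pat3.xs_y Pat3.ys_x) Pat3.xs_y Pat3.ys_x = true := by
  decide +kernel


set_option maxHeartbeats 4000000 in
/-- Representative first-pair loop `(Pat3.xs_y, Pat3.sep)` (census g40 `FK.loop1R`: second/third pairs `P ≤ Q` only; target `symm8d (coefGet3 …)`, `m = 8`). -/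
theorem eeeKtriadbd_starXm_rep_2_4 :
    loop1R (symm8d (coefGet3 eeeKtriadbd_starXmCoef)) 8 8 8 (eeeKtriadbd_starXmProds.filter fun p => suppAt p.gK Pat3.xs_y Pat3.sep) Pat3.xs_y Pat3.sep = true := by
  decide +kernel


set_option maxHeartbeats 4000000 in
/-- Representative first-pair loop `(Pat3.ys_x, Pat3.ys_x)` (census g40 `FK.loop1R`: second/third pairs `P ≤ Q` only; target `symm8d (coefGet3 …)`, `m = 8`). -/
theorem eeeKtriadbd_starXm_rep_3_3 :
    loop1R (symm8d (coefGet3 eeeKtriadbd_starXmCoef)) 8 8 8 (eeeKtriadbd_starXmProds.filter fun p => suppAt p.gK Pat3.ys_x Pat3.ys_x) Pat3.ys_x Pat3.ys_x = true := by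
  decide +kernel


set_option maxHeartbeats 4000000 in
/-- Representative first-pair loop `(Pat3.ys_x, Pat3.sep)` (census g40 `FK.loop1R`: second/third pairs `P ≤ Q` only; target `symm8d (coefGet3 …)`, `m = 8`). -/
theorem eeeKtriadbd_starXm_rep_3_4 :
    loop1R (symm8d (coefGet3 eeeKtriadbd_starXmCoef)) 8 8 8 (eeeKtriadbd_starXmProds.filter fun p => suppAt p.gK Pat3.ys_x Pat3.sep) Pat3.ys_x Pat3.sep = true := by
  decide +kernel


set_option maxHeartbeats 4000000 in
/-- Representative first-pair loop `(Pat3.sep, Pat3.sep)` (census g40 `FK.loop1R`: second/third pairs `P ≤ Q` only; target `symm8d (coefGet3 …)`, `m = 8`). -/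
theorem eeeKtriadbd_starXm_rep_4_4 :
    loop1R (symm8d (coefGet3 eeeKtriadbd_starXmCoef)) 8 8 8 (eeeKtriadbd_starXmProds.filter fun p => suppAt p.gK Pat3.sep Pat3.sep) Pat3.sep Pat3.sep = true := by
  decide +kernel


/-- All fifteen representative first-pair loops of `EEEtri_Kadbd` × `mirror2 starXTab` pass. -/
theorem eeeKtriadbd_starXm_reps : ∀ pq ∈ Pat3.pairsLE,
    loop1R (symm8d (coefGet3 eeeKtriadbd_starXmCoef)) 8 8 8 (eeeKtriadbd_starXmProds.filter fun p => suppAt p.gK pq.1 pq.2) pq.1 pq.2 = true := by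
  intro pq hpq
  fin_cases hpq
  exacts [eeeKtriadbd_starXm_rep_0_0, eeeKtriadbd_starXm_rep_0_1, eeeKtriadbd_starXm_rep_0_2, eeeKtriadbd_starXm_rep_0_3, eeeKtriadbd_starXm_rep_0_4, eeeKtriadbd_starXm_rep_1_1, eeeKtriadbd_starXm_rep_1_2, eeeKtriadbd_starXm_rep_1_3, eeeKtriadbd_starXm_rep_1_4, eeeKtriadbd_starXm_rep_2_2, eeeKtriadbd_starXm_rep_2_3, eeeKtriadbd_starXm_rep_2_4, eeeKtriadbd_starXm_rep_3_3, eeeKtriadbd_starXm_rep_3_4, eeeKtriadbd_starXm_rep_4_4]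


/-- **The rows of the leaf `EEEtri_Kadbd` × `mirror2 starXTab`**: census g39's certificate dominates rowwise (feeds `FK.shape3C_nonneg_of_rows`). -/
theorem eeeKtriadbd_starXm_rows : ∀ (d : ℕ) (PK QK P1 Q1 P2 Q2 : Pat3),
    8 * (eeeKtriadbd_starXmProds.map fun q => (q.lam : ℤ) * q.tensor d PK QK P1 Q1 P2 Q2).sum ≤
      (8 : ℤ) * symm8d (coefTab3K eeeKtriadbdSkelL eeeKtriadbdSkelK (0 : Fin 7) 1 4 1 2 5 2 0 6 4 5 6 (mirror2 starXTab)) d PK QK P1 Q1 P2 Q2 :=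
  rows_of_tab3RK (by decide) eeeKtriadbdSide_ok eeeKtriadbd_starXmCoef_ok (by decide +kernel) (by decide +kernel) eeeKtriadbd_starXm_sym eeeKtriadbd_starXm_reps

end FK

end Summit.CriticalPhenomena.PercolationContinuityZ3.Theorems
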